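import Literature.MathematicalPhysics.QuantumFieldTheory.StrongCouplingTorusSystem

/-!
# Joining label sets are long: the torus time-distance bound

Support file for `StrongCouplingShape` (route `ConvexGribovBody`, item stmt-QuantumFields-8783).
For a plaquette system `S : PlaqSystem d G ι` (`StrongCouplingPolymerSystem`) and a "distance"
`δ` on bonds satisfying the triangle inequality, with the bonds of every label pairwise at
`δ`-distance `≤ 1`, a label set `R` joining two bond sets at `δ`-distance `≥ m` has at least
`m` labels (`le_card_of_joins`: along a chain of labels sharing bonds the distance from the
first bond set grows by at most one per label, and every intermediate level is attained).

On the discrete torus of odd side `2s+1` (`torusSystem ρ (2s+1)` of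
`StrongCouplingTorusSystem`) the relevant distance is the torus distance of the `i`-th base
coordinates of two bonds, `|valMinAbs (xᵢ - yᵢ mod 2s+1)|`; for a support `B_A` and the
translate by `n ≤ s` lattice units along the axis `i` of a support `B_B`, both within `r` of
the origin along `i`, joining sets have at least `n - 2r` labels (`le_card_of_joins_torus`).
-/

noncomputable section

open Finset
open Literature.MathematicalPhysics.QuantumFieldTheory

namespace Summit.QuantumFields.YangMills.Theorems.StrongCouplingShape

variable {d : ℕ} {G : Type*} {ι : Type*}

/-- `𝓙[S, B, R]`: the part of the label set `R` joined to the bond set `B` through `R`. -/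
local notation "𝓙[" S ", " B ", " R "]" =>
  Polymer.seedReach (PlaqSystem.Adj S) (PlaqSystem.Touches S B) R

/-! ### Joining sets are long -/

section Abstract

variable {S : PlaqSystem d G ι}

/-- **Joining label sets are long.** Let `δ` be a distance on bonds (zero on the diagonal,
triangle inequality) for which the bonds of every label are pairwise within distance `1`. If
`R` joins `B₁` to `B₂` (the sets meet, or a label of `R` joined to `B₁` through `R` touches `B₂`)
and all bonds of `B₁` are at distance `≥ m` from all bonds of `B₂`, then `m ≤ |R|`. [folklore] -/
theorem le_card_of_joins (δ : ZdEdge d → ZdEdge d → ℕ) (hδ0 : ∀ a, δ a a = 0)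
    (hδ : ∀ a b c, δ a c ≤ δ a b + δ b c)
    (hS : ∀ p, ∀ b ∈ S.bonds p, ∀ b' ∈ S.bonds p, δ b b' ≤ 1)
    {B₁ B₂ : Finset (ZdEdge d)} {R : Finset ι}
    (hJ : ¬ Disjoint B₁ B₂ ∨ ∃ p ∈ 𝓙[S, B₁, R], S.Touches B₂ p) {m : ℕ}
    (hm : ∀ b ∈ B₁, ∀ b' ∈ B₂, m ≤ δ b b') : m ≤ R.card := by
  rcases hJ with hBB | ⟨p, hp, hpB₂⟩
  · obtain ⟨b, hb₁, hb₂⟩ := Finset.not_disjoint_iff.1 hBB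
    have h := hm b hb₁ b hb₂
    rw [hδ0] at h
    exact (Nat.le_zero.1 h).le.trans (Nat.zero_le _)
  · obtain ⟨-, t, htR, htB₁, htp⟩ := Polymer.mem_seedReach.1 hp
    -- the level function: distance of the bonds of a label from `B₁`
    set D : ι → ℕ := fun q => sInf {n | ∃ b ∈ B₁, ∃ c ∈ S.bonds q, δ b c = n} with hD
    have hB₁ne : B₁.Nonempty := by
      obtain ⟨c, -, hcB⟩ := Finset.not_disjoint_iff.1 htB₁
      exact ⟨c, hcB⟩
    have hne : ∀ q, {n | ∃ b ∈ B₁, ∃ c ∈ S.bonds q, δ b c = n}.Nonempty := fun q => by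
      obtain ⟨b, hb⟩ := hB₁ne
      obtain ⟨c, hc⟩ := S.bonds_nonempty q
      exact ⟨δ b c, b, hb, c, hc, rfl⟩
    have hDspec : ∀ q, ∃ b ∈ B₁, ∃ c ∈ S.bonds q, δ b c = D q := fun q => Nat.sInf_mem (hne q)
    have hDle : ∀ q, ∀ b ∈ B₁, ∀ c ∈ S.bonds q, D q ≤ δ b c := fun q b hb c hc =>
      Nat.sInf_le ⟨b, hb, c, hc, rfl⟩
    have hDt : D t = 0 := by
      obtain ⟨c, hct, hcB⟩ := Finset.not_disjoint_iff.1 htB₁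
      have h := hDle t c hcB c hct
      rw [hδ0] at h
      exact Nat.le_zero.1 h
    -- the level changes by at most one between labels sharing a bond
    have hstep : ∀ u v, S.Adj u v → D v ≤ D u + 1 := by
      intro u v huv
      obtain ⟨b, hb, c, hc, hbc⟩ := hDspec u
      obtain ⟨e, heu, hev⟩ := S.adj_iff.1 huv
      calc D v ≤ δ b e := hDle v b hb e hev
        _ ≤ δ b c + δ c e := hδ b c e
        _ ≤ D u + 1 := by rw [hbc]; exact Nat.add_le_add_left (hS u c hc e heu) _
    -- every level up to `D p` is attained in `R`
    have hsub : Finset.range (D p + 1) ⊆ R.image D := by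
      intro j hj
      rw [Finset.mem_range] at hj
      obtain ⟨c, hcR, hc⟩ := Polymer.exists_mem_apply_eq_of_reflTransGen (adj := S.Adj) hstep htR
        htp (m := j) (by rw [hDt]; exact Nat.zero_le _) (by omega)
      exact Finset.mem_image.2 ⟨c, hcR, hc⟩
    have hcard : D p + 1 ≤ R.card :=
      calc D p + 1 = (Finset.range (D p + 1)).card := (Finset.card_range _).symm
        _ ≤ (R.image D).card := Finset.card_le_card hsub
        _ ≤ R.card := Finset.card_image_le
    obtain ⟨b, hb, c, hc, hbc⟩ := hDspec p
    obtain ⟨c', hc'p, hc'B⟩ := Finset.not_disjoint_iff.1 hpB₂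
    calc m ≤ δ b c' := hm b hb c' hc'B
      _ ≤ δ b c + δ c c' := hδ b c c'
      _ ≤ D p + 1 := by rw [hbc]; exact Nat.add_le_add_left (hS p c hc c' hc'p) _
      _ ≤ R.card := hcard

end Abstract

/-! ### The torus distance of residues -/

section Residues

/-- The minimal-absolute-value representative is minimal: `|valMinAbs z̄| ≤ |z|`. [folklore] -/
theorem natAbs_valMinAbs_intCast_le (L : ℕ) [NeZero L] (z : ℤ) :
    ((z : ZMod L).valMinAbs).natAbs ≤ z.natAbs :=
  ZMod.natAbs_min_of_le_div_two L _ _ (ZMod.coe_valMinAbs _) (ZMod.natAbs_valMinAbs_le _)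

/-- Triangle inequality for the torus distance `|valMinAbs (x - y)|` on `ℤ/Lℤ`. [folklore] -/
theorem natAbs_valMinAbs_sub_le (L : ℕ) (x y z : ZMod L) :
    ((x - z).valMinAbs).natAbs ≤ ((x - y).valMinAbs).natAbs + ((y - z).valMinAbs).natAbs := by
  have h := ZMod.natAbs_valMinAbs_add_le (x - y) (y - z)
  rw [sub_add_sub_cancel] at h
  exact h.trans (Int.natAbs_add_le _ _)

/-- **No short way around an odd torus.** On `ℤ/(2s+1)ℤ`, for `n ≤ s` and any integer `t`, the
residue of `n + t` is at torus distance at least `n - |t|` from `0`. [folklore] -/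
theorem le_natAbs_valMinAbs_add (s n : ℕ) (hn : n ≤ s) (t : ℤ) {x : ZMod (2 * s + 1)}
    (hx : x = (((n : ℤ) + t : ℤ) : ZMod (2 * s + 1))) : n ≤ (x.valMinAbs).natAbs + t.natAbs := by
  by_contra h
  push Not at h
  have hdvd : ((2 * s + 1 : ℕ) : ℤ) ∣ ((n : ℤ) + t) - x.valMinAbs :=
    (ZMod.intCast_eq_intCast_iff_dvd_sub _ _ _).1 (by rw [ZMod.coe_valMinAbs, hx])
  have hle : (x.valMinAbs).natAbs ≤ (2 * s + 1) / 2 := ZMod.natAbs_valMinAbs_le x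
  have hs : (2 * s + 1) / 2 = s := by omega
  rw [hs] at hle
  have hpos : 0 < ((n : ℤ) + t) - x.valMinAbs := by omega
  have h2 := Int.le_of_dvd hpos hdvd
  push_cast at h2
  omega

end Residues

/-! ### The torus plaquette system: bonds of a label are close, translates are far -/

section Torus

variable {N : ℕ} [Group G] (ρ : G →* Matrix (Fin N) (Fin N) ℂ) {L : ℕ} [NeZero L] (i : Fin d)

/-- The `i`-th residue of a bond read through the section is the `i`-th torus coordinate.
[folklore] -/
theorem intCast_torusSect_apply (e : Edge d L) :
    (((torusSect L e).1 i : ℤ) : ZMod L) = e.1 i := by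
  simp [torusSect, torusSiteLift]

/-- The `i`-th residue of a reduced bond is the residue of its `i`-th coordinate. [folklore] -/
theorem intCast_torusRed_apply (e : ZdEdge d) :
    (((torusRed L e).1 i : ℤ) : ZMod L) = ((e.1 i : ℤ) : ZMod L) := by
  rw [torusRed, intCast_torusSect_apply]
  simp [Literature.MathematicalPhysics.QuantumLattice.torusEdge,
    Literature.Probability.LatticeModels.Torus.proj_apply]

/-- The bonds of a torus label have `i`-th coordinates `xᵢ` or `xᵢ + 1`, `x` the base point.
[folklore] -/
theorem exists_intCast_eq_of_mem_bonds (p : TPlaq d L) {b : ZdEdge d}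
    (hb : b ∈ (torusSystem (G := G) ρ L).bonds p) :
    ∃ c : ZMod L, (c = 0 ∨ c = 1) ∧ ((b.1 i : ℤ) : ZMod L) = p.1 i + c := by
  rw [torusSystem_bonds, Finset.mem_image] at hb
  obtain ⟨e, he, rfl⟩ := hb
  rw [intCast_torusSect_apply]
  have key : ∀ k : Fin d, ∃ c : ZMod L, (c = 0 ∨ c = 1) ∧ (p.1.shift k) i = p.1 i + c := by
    intro k
    refine ⟨(Pi.single k (1 : ZMod L) : Site d L) i, ?_, by simp [Site.shift]⟩
    by_cases hik : i = k
    · subst hik; simp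
    · simp [hik]
  simp only [TPlaq.tbonds, Finset.mem_insert, Finset.mem_singleton] at he
  rcases he with rfl | rfl | rfl | rfl
  · exact ⟨0, Or.inl rfl, by simp⟩
  · exact key p.2.1
  · exact key p.2.2
  · exact ⟨0, Or.inl rfl, by simp⟩

/-- **The bonds of a torus label are pairwise at torus time-distance at most one.** [folklore] -/
theorem natAbs_valMinAbs_bonds_le_one (p : TPlaq d L) {b b' : ZdEdge d}
    (hb : b ∈ (torusSystem (G := G) ρ L).bonds p) (hb' : b' ∈ (torusSystem (G := G) ρ L).bonds p) :
    ((((b.1 i : ℤ) : ZMod L) - ((b'.1 i : ℤ) : ZMod L)).valMinAbs).natAbs ≤ 1 := by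
  obtain ⟨c, hc, hbc⟩ := exists_intCast_eq_of_mem_bonds ρ i p hb
  obtain ⟨c', hc', hbc'⟩ := exists_intCast_eq_of_mem_bonds ρ i p hb'
  rw [hbc, hbc', add_sub_add_left_eq_sub]
  have h1 : (((1 : ZMod L)).valMinAbs).natAbs ≤ 1 := by
    have h := natAbs_valMinAbs_intCast_le L 1
    rwa [Int.cast_one] at h
  rcases hc with rfl | rfl <;> rcases hc' with rfl | rfl
  · simp
  · rw [zero_sub, ZMod.natAbs_valMinAbs_neg]; exact h1
  · rw [sub_zero]; exact h1
  · simp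

/-- **Joining sets on the odd torus are long.** On the torus of side `2s+1`, let `B_A`, `B_B`
be bond sets whose `i`-th coordinates are bounded by `r` in absolute value, and translate `B_B`
by `v` with `vᵢ = -n`, `n ≤ s` (the support of `F ∘ configShift v` for `F` supported on `B_B`).
Every label set of the torus system joining the reduction of `B_A` to the reduction of the
translate has at least `n - 2r` labels: a chain of plaquettes sharing bonds advances the time
coordinate by at most one unit per plaquette, and there is no shorter way around the torus
since `2s + 1 - n > n`. [folklore] -/
theorem le_card_of_joins_torus (s n : ℕ) (hn : n ≤ s) {B_A B_B : Finset (ZdEdge d)} {r : ℕ}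
    (hrA : ∀ e ∈ B_A, (e.1 i).natAbs ≤ r) (hrB : ∀ e ∈ B_B, (e.1 i).natAbs ≤ r)
    (v : Literature.Probability.LatticeModels.Site d) (hv : v i = -(n : ℤ))
    {R : Finset (TPlaq d (2 * s + 1))}
    (hJ : ¬ Disjoint (B_A.image (torusRed (2 * s + 1)))
        ((B_B.image fun e => (e.1 - v, e.2)).image (torusRed (2 * s + 1))) ∨
      ∃ p ∈ 𝓙[torusSystem ρ (2 * s + 1), B_A.image (torusRed (2 * s + 1)), R],
        (torusSystem ρ (2 * s + 1)).Touches
          ((B_B.image fun e => (e.1 - v, e.2)).image (torusRed (2 * s + 1))) p) :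
    n - 2 * r ≤ R.card := by
  refine le_card_of_joins (S := torusSystem ρ (2 * s + 1))
    (fun a b : ZdEdge d => ((((a.1 i : ℤ) : ZMod (2 * s + 1)) -
      ((b.1 i : ℤ) : ZMod (2 * s + 1))).valMinAbs).natAbs)
    (fun a => by simp) (fun a b c => natAbs_valMinAbs_sub_le _ _ _ _)
    (fun p b hb b' hb' => natAbs_valMinAbs_bonds_le_one ρ i p hb hb') hJ ?_
  intro b hb b' hb'
  obtain ⟨a, ha, rfl⟩ := Finset.mem_image.1 hb
  obtain ⟨e', he', rfl⟩ := Finset.mem_image.1 hb'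
  obtain ⟨e, he, rfl⟩ := Finset.mem_image.1 he'
  rw [intCast_torusRed_apply, intCast_torusRed_apply]
  dsimp only
  have ht : (e.1 i - a.1 i).natAbs ≤ 2 * r := by
    have h1 := hrA a ha
    have h2 := hrB e he
    omega
  have hx : -((((a.1 i : ℤ) : ZMod (2 * s + 1)) - (((e.1 - v) i : ℤ) : ZMod (2 * s + 1)))) =
      (((n : ℤ) + (e.1 i - a.1 i) : ℤ) : ZMod (2 * s + 1)) := by
    simp only [Pi.sub_apply, hv]
    push_cast
    ring
  have key := le_natAbs_valMinAbs_add s n hn (e.1 i - a.1 i) hx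
  rw [ZMod.natAbs_valMinAbs_neg] at key
  omega

end Torus

end Summit.QuantumFields.YangMills.Theorems.StrongCouplingShape

end
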